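import Summits.PneNP.PneNP.Theses.PhaseTwins
import Literature.ModelTheory.FiniteModelTheory.CkEquivHomCount

/-!
# `MacroscopicTwinsAbove` (stmt-PneNP-2720, route PneNP/PhaseTwins) — negative side I: the defect bound and the size of witnesses

Standing-adversary (cdisprove) lemmas for `Summit.PneNP.PneNP.Theses.PhaseTwins.MacroscopicTwinsAbove`
(`∀ Δ ≥ 3 ∀ λ > λ_c(Δ) ∃ δ > 0 ∀ k ∃` max-degree-`≤ Δ` twins `G ≡_{C^k} H` on `n ≥ 1` vertices with
`e^{δn} Z_H(λ) ≤ Z_G(λ)`). The crux is NOT refuted and NOT mis-stated; these are necessary conditions on witnesses.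
* `Z` (the crux's inlined hard-core sum), `lamC`, `HomIndist`, `Witness`, `crux_iff` (`Iff.rfl`); `one_le_Z`, `Z_pos`,
  `Z_le_pow`, `Z_comap_equiv`, `Z_eq_of_iso`.
* DEFECT (edit-distance) BOUND `Z_le_pow_mul_Z_of_agree_off`: if `G`, `H` agree outside `S` then
  `Z_H ≤ (1+λ)^{|S|} Z_G`. Hence `defect_bound` (`δn ≤ |S| log(1+λ)`), `defect_bound_perm` (under any relabelling),
  `delta_le_log` (`δ ≤ log(1+λ)`), `delta_le_of_blocks` (`|S| ≤ sM`, blocks `≥ b`, `Mb ≤ n` ⇒ `δ ≤ s log(1+λ)/b`).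
  Message to provers: twins must differ on `Ω(δn/log(1+λ))` vertices under the best alignment — a bare CFI pair
  (one twisted edge: agreement off 4 vertices) has ratio `≤ (1+λ)^4` on EVERY base, stacked CFI pairs over bases of
  treewidth `≥ k` force `δ_k ≤ 4log(1+λ)/k → 0`, and one violated Tseitin vertex gives only `e^{o(n)}`: witnesses
  need `Θ(n)` non-gaugeable defects (Atserias–Dawar Thm 8-type systems, proved in the tree).
* `lt_card_of_witness`: every witness at depth `k` has `k < n` (`iso_of_ckEquiv_of_card_le`: with `≥ n` pebble pairs
  Duplicator's strategy is an isomorphism; plus the proved Dvořák bridge and `Z_eq_of_iso`); `not_singlePair`.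
Part II (`LoadBearing.lean`): load-bearing hypotheses and the exact shape of a refutation.
Refuter seat cdisprove-stmt-PneNP-2720, 2026-08-16; commentary in `Summits/PneNP/PneNP/Cruxes/MacroscopicTwinsAbove/Disproof.lean`.
-/

set_option linter.dupNamespace false

namespace Summit.PneNP.PneNP.Theorems.MacroscopicTwinsAbove.Negative

open scoped Classical BigOperators
open Finset

/-- The hard-core partition function `Z_G(λ) = Σ_{I independent} λ^{|I|}`, literally the sum
inlined in the crux. -/
noncomputable def Z {n : ℕ} (G : SimpleGraph (Fin n)) (lam : ℝ) : ℝ :=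
  ∑ I : Finset (Fin n), if G.IsIndepSet (↑I : Set (Fin n)) then lam ^ I.card else 0

/-- `Z_G(λ) ≥ 1` for `λ ≥ 0` (the empty set is independent). [folklore] -/
theorem one_le_Z {n : ℕ} (G : SimpleGraph (Fin n)) {lam : ℝ} (hlam : 0 ≤ lam) : 1 ≤ Z G lam := by
  have hterm : ∀ I ∈ (univ : Finset (Finset (Fin n))),
      0 ≤ (if G.IsIndepSet (↑I : Set (Fin n)) then lam ^ I.card else 0) := fun I _ => by
    split_ifs <;> positivity
  have h := Finset.single_le_sum hterm (Finset.mem_univ (∅ : Finset (Fin n)))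
  have hempty : G.IsIndepSet (↑(∅ : Finset (Fin n)) : Set (Fin n)) := by
    simp [SimpleGraph.isIndepSet_iff, Set.Pairwise]
  simp only [hempty, if_true, Finset.card_empty, pow_zero] at h
  exact h

/-- `Z_G(λ) > 0` for `λ ≥ 0`. [folklore] -/
theorem Z_pos {n : ℕ} (G : SimpleGraph (Fin n)) {lam : ℝ} (hlam : 0 ≤ lam) : 0 < Z G lam :=
  lt_of_lt_of_le one_pos (one_le_Z G hlam)

/-- `Z_G(λ) ≤ (1+λ)^n` for `λ ≥ 0`. [folklore] -/
theorem Z_le_pow {n : ℕ} (G : SimpleGraph (Fin n)) {lam : ℝ} (hlam : 0 ≤ lam) :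
    Z G lam ≤ (1 + lam) ^ n := by
  have h1 : Z G lam ≤ ∑ I : Finset (Fin n), lam ^ I.card := by
    refine Finset.sum_le_sum fun I _ => ?_
    split_ifs
    · exact le_rfl
    · positivity
  have h2 : ∑ I : Finset (Fin n), lam ^ I.card = (1 + lam) ^ n := by
    have := Fintype.sum_pow_mul_eq_add_pow (Fin n) lam 1
    simp only [one_pow, mul_one, Fintype.card_fin] at this
    rw [this, add_comm]
  linarith

/-- **Edit-distance bound.** If `G` and `H` have the same adjacency outside a vertex set `S`,
then `Z_H(λ) ≤ (1+λ)^{|S|} · Z_G(λ)`: split an `H`-independent set `I` as `(I ∩ S) ⊔ (I \ S)`;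
the second part is `G`-independent. [folklore] -/
theorem Z_le_pow_mul_Z_of_agree_off {n : ℕ} (G H : SimpleGraph (Fin n)) (S : Finset (Fin n))
    (hagree : ∀ u v, u ∉ S → v ∉ S → (G.Adj u v ↔ H.Adj u v)) {lam : ℝ} (hlam : 0 ≤ lam) :
    Z H lam ≤ (1 + lam) ^ S.card * Z G lam := by
  set T : Finset (Finset (Fin n)) :=
    univ.filter (fun J : Finset (Fin n) => J ∩ S = ∅ ∧ G.IsIndepSet (↑J : Set (Fin n))) with hT
  set IH : Finset (Finset (Fin n)) :=
    univ.filter (fun I : Finset (Fin n) => H.IsIndepSet (↑I : Set (Fin n))) with hIH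
  set IG : Finset (Finset (Fin n)) :=
    univ.filter (fun I : Finset (Fin n) => G.IsIndepSet (↑I : Set (Fin n))) with hIG
  have hZH : Z H lam = ∑ I ∈ IH, lam ^ I.card := by rw [Z, Finset.sum_filter]
  have hZG : Z G lam = ∑ I ∈ IG, lam ^ I.card := by rw [Z, Finset.sum_filter]
  let φ : Finset (Fin n) → Finset (Fin n) × Finset (Fin n) := fun I => (I ∩ S, I \ S)
  have hinj : ∀ I ∈ IH, ∀ I' ∈ IH, φ I = φ I' → I = I' := by
    intro I _ I' _ h
    simp only [φ, Prod.mk.injEq] at h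
    rw [← Finset.sdiff_union_inter I S, ← Finset.sdiff_union_inter I' S, h.1, h.2]
  have himage : IH.image φ ⊆ S.powerset ×ˢ T := by
    intro p hp
    rw [Finset.mem_image] at hp
    obtain ⟨I, hI, rfl⟩ := hp
    rw [hIH, Finset.mem_filter] at hI
    simp only [φ, Finset.mem_product, Finset.mem_powerset, hT, Finset.mem_filter,
      Finset.mem_univ, true_and]
    refine ⟨Finset.inter_subset_right, ?_, ?_⟩
    · ext x
      simp
    · intro u hu v hv huv
      have hu' := Finset.mem_sdiff.1 (Finset.mem_coe.1 hu)
      have hv' := Finset.mem_sdiff.1 (Finset.mem_coe.1 hv)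
      rw [hagree u v hu'.2 hv'.2]
      exact hI.2 hu'.1 hv'.1 huv
  calc Z H lam = ∑ I ∈ IH, lam ^ I.card := hZH
    _ = ∑ I ∈ IH, (fun p : Finset (Fin n) × Finset (Fin n) =>
          lam ^ p.1.card * lam ^ p.2.card) (φ I) := by
        refine Finset.sum_congr rfl fun I _ => ?_
        simp only [φ]
        rw [← pow_add, Finset.card_inter_add_card_sdiff]
    _ = ∑ p ∈ IH.image φ, lam ^ p.1.card * lam ^ p.2.card :=
        (Finset.sum_image (f := fun p : Finset (Fin n) × Finset (Fin n) =>
          lam ^ p.1.card * lam ^ p.2.card) hinj).symm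
    _ ≤ ∑ p ∈ S.powerset ×ˢ T, lam ^ p.1.card * lam ^ p.2.card :=
        Finset.sum_le_sum_of_subset_of_nonneg himage fun p _ _ => by positivity
    _ = (∑ A ∈ S.powerset, lam ^ A.card) * ∑ J ∈ T, lam ^ J.card := by
        rw [Finset.sum_product, Finset.sum_mul_sum]
    _ = (1 + lam) ^ S.card * ∑ J ∈ T, lam ^ J.card := by
        congr 1
        have := Finset.sum_pow_mul_eq_add_pow lam 1 S
        simp only [one_pow, mul_one] at this
        rw [this, add_comm]
    _ ≤ (1 + lam) ^ S.card * Z G lam := by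
        rw [hZG]
        refine mul_le_mul_of_nonneg_left ?_ (by positivity)
        refine Finset.sum_le_sum_of_subset_of_nonneg ?_ fun J _ _ => by positivity
        intro J hJ
        rw [hT, Finset.mem_filter] at hJ
        rw [hIG, Finset.mem_filter]
        exact ⟨Finset.mem_univ _, hJ.2.2⟩


/-- `Z` is invariant under relabelling the vertices (pull back along a permutation). [folklore] -/
theorem Z_comap_equiv {n : ℕ} (H : SimpleGraph (Fin n)) (σ : Fin n ≃ Fin n) (lam : ℝ) :
    Z (H.comap σ) lam = Z H lam := by
  unfold Z
  refine Fintype.sum_equiv (Equiv.finsetCongr σ) _ _ fun I => ?_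
  have hiff : (H.comap σ).IsIndepSet (↑I : Set (Fin n)) ↔
      H.IsIndepSet (↑(Equiv.finsetCongr σ I) : Set (Fin n)) := by
    rw [Equiv.finsetCongr_apply, Finset.coe_map, Equiv.coe_toEmbedding,
      SimpleGraph.isIndepSet_iff, SimpleGraph.isIndepSet_iff,
      Set.InjOn.pairwise_image σ.injective.injOn]
    rfl
  rw [Equiv.finsetCongr_apply, Finset.card_map, ← Equiv.finsetCongr_apply]
  by_cases h : (H.comap σ).IsIndepSet (↑I : Set (Fin n))
  · rw [if_pos h, if_pos (hiff.1 h)]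
  · rw [if_neg h, if_neg (fun h' => h (hiff.2 h'))]

/-- `Z` is an isomorphism invariant. [folklore] -/
theorem Z_eq_of_iso {n : ℕ} {G H : SimpleGraph (Fin n)} (e : G ≃g H) (lam : ℝ) :
    Z G lam = Z H lam := by
  have hG : G = H.comap e.toEquiv := by
    ext u v
    exact (e.map_rel_iff).symm
  rw [hG]
  exact Z_comap_equiv H e.toEquiv lam

/-- **Defect bound.** If `e^{δ n} · Z_H ≤ Z_G` and `G`, `H` agree outside `S`, then
`δ · n ≤ |S| · log (1 + λ)`. [folklore] -/
theorem defect_bound {n : ℕ} {G H : SimpleGraph (Fin n)} {S : Finset (Fin n)}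
    (hagree : ∀ u v, u ∉ S → v ∉ S → (G.Adj u v ↔ H.Adj u v)) {lam δ : ℝ} (hlam : 0 ≤ lam)
    (hgap : Real.exp (δ * n) * Z H lam ≤ Z G lam) :
    δ * n ≤ S.card * Real.log (1 + lam) := by
  have h1 : Z G lam ≤ (1 + lam) ^ S.card * Z H lam :=
    Z_le_pow_mul_Z_of_agree_off H G S (fun u v hu hv => (hagree u v hu hv).symm) hlam
  have hZH := Z_pos H hlam
  have h2 : Real.exp (δ * n) ≤ (1 + lam) ^ S.card := le_of_mul_le_mul_right (hgap.trans h1) hZH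
  have h3 : (1 + lam) ^ S.card = Real.exp (S.card * Real.log (1 + lam)) := by
    rw [Real.exp_nat_mul, Real.exp_log (by linarith)]
  rw [h3, Real.exp_le_exp] at h2
  exact h2

/-- The same after an arbitrary relabelling `σ` of `H`: twins with a macroscopic gap are far apart
in EDIT DISTANCE under every vertex bijection. [folklore] -/
theorem defect_bound_perm {n : ℕ} {G H : SimpleGraph (Fin n)} (σ : Fin n ≃ Fin n)
    {S : Finset (Fin n)}
    (hagree : ∀ u v, u ∉ S → v ∉ S → (G.Adj u v ↔ H.Adj (σ u) (σ v))) {lam δ : ℝ}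
    (hlam : 0 ≤ lam) (hgap : Real.exp (δ * n) * Z H lam ≤ Z G lam) :
    δ * n ≤ S.card * Real.log (1 + lam) := by
  refine defect_bound (G := G) (H := H.comap σ) (S := S) (fun u v hu hv => ?_) hlam ?_
  · rw [SimpleGraph.comap_adj]
    exact hagree u v hu hv
  · rwa [Z_comap_equiv]

/-- In particular (`S = univ`): `δ ≤ log (1 + λ)` for every witness on `n ≥ 1` vertices. [folklore] -/
theorem delta_le_log {n : ℕ} {G H : SimpleGraph (Fin n)} (hn : 0 < n) {lam δ : ℝ}
    (hlam : 0 ≤ lam) (hgap : Real.exp (δ * n) * Z H lam ≤ Z G lam) :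
    δ ≤ Real.log (1 + lam) := by
  have h := defect_bound (G := G) (H := H) (S := Finset.univ)
    (fun u v hu _ => (hu (Finset.mem_univ u)).elim) hlam hgap
  rw [Finset.card_univ, Fintype.card_fin] at h
  have hn' : (0 : ℝ) < n := Nat.cast_pos.2 hn
  nlinarith


/-- **Block form of the defect bound.** If the defect set has `|S| ≤ s·M` (at most `s` vertices in each of
`M` blocks), blocks have `≥ b` vertices and `M·b ≤ n`, then `δ ≤ s·log(1+λ)/b`. For disjoint unions of CFI
pairs over bases of treewidth `≥ k` (`s = 4`, `b > k`) this forces `δ_k → 0`. [folklore] -/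
theorem delta_le_of_blocks {n : ℕ} {G H : SimpleGraph (Fin n)} {S : Finset (Fin n)}
    (hagree : ∀ u v, u ∉ S → v ∉ S → (G.Adj u v ↔ H.Adj u v)) {lam δ : ℝ} (hlam : 0 ≤ lam)
    (hgap : Real.exp (δ * n) * Z H lam ≤ Z G lam) {s M b : ℕ} (hS : S.card ≤ s * M)
    (hMb : M * b ≤ n) (hb : 0 < b) (hn : 0 < n) : δ ≤ s * Real.log (1 + lam) / b := by
  have h := defect_bound hagree hlam hgap
  have hlog : 0 ≤ Real.log (1 + lam) := Real.log_nonneg (by linarith)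
  have hS' : (S.card : ℝ) ≤ s * M := by exact_mod_cast hS
  have hMb' : (M : ℝ) * b ≤ n := by exact_mod_cast hMb
  have hn' : (0 : ℝ) < n := by exact_mod_cast hn
  have hb' : (0 : ℝ) < b := by exact_mod_cast hb
  have h1 : δ * n ≤ s * M * Real.log (1 + lam) :=
    h.trans (mul_le_mul_of_nonneg_right hS' hlog)
  rw [le_div_iff₀ hb']
  have h2 : δ * b * n ≤ s * Real.log (1 + lam) * n :=
    calc δ * b * n = δ * n * b := by ring
      _ ≤ s * M * Real.log (1 + lam) * b := mul_le_mul_of_nonneg_right h1 hb'.le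
      _ = s * Real.log (1 + lam) * (M * b) := by ring
      _ ≤ s * Real.log (1 + lam) * n := mul_le_mul_of_nonneg_left hMb' (by positivity)
  exact le_of_mul_le_mul_right h2 hn'

/-- The tree-uniqueness threshold `λ_c(Δ) = (Δ-1)^{Δ-1}/(Δ-2)^Δ` exactly as typed in the crux
(natural-number subtraction in the exponent; junk values `1, -1, 0` at `Δ = 0, 1, 2`). -/
noncomputable def lamC (Δ : ℕ) : ℝ := ((Δ : ℝ) - 1) ^ (Δ - 1) / ((Δ : ℝ) - 2) ^ Δ

/-- `λ_c(3) = 4`. [folklore] -/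
theorem lamC_three : lamC 3 = 4 := by norm_num [lamC]
/-- Junk value `λ_c(0) = 1` of the typed threshold formula. [folklore] -/
theorem lamC_zero : lamC 0 = 1 := by norm_num [lamC]

/-- `λ_c(Δ) > 0` for `Δ ≥ 3`. [folklore] -/
theorem lamC_pos {Δ : ℕ} (hΔ : 3 ≤ Δ) : 0 < lamC Δ := by
  unfold lamC
  have h3 : (3 : ℝ) ≤ Δ := by exact_mod_cast hΔ
  apply div_pos <;> apply pow_pos <;> linarith

/-- Homomorphism indistinguishability over treewidth `< k`, as typed in the crux. -/
def HomIndist (k : ℕ) {n : ℕ} (G H : SimpleGraph (Fin n)) : Prop :=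
  ∀ (m : ℕ) (F : SimpleGraph (Fin m)), Literature.Combinatorics.SimpleGraph.treewidth F < k →
    Nat.card (F →g G) = Nat.card (F →g H)

/-- A witness of the crux at `(Δ, λ, δ, k)`: twins on `n ≥ 1` vertices. -/
def Witness (Δ : ℕ) (lam δ : ℝ) (k n : ℕ) (G H : SimpleGraph (Fin n)) : Prop :=
  0 < n ∧ G.maxDegree ≤ Δ ∧ H.maxDegree ≤ Δ ∧ HomIndist k G H ∧
    Real.exp (δ * n) * Z H lam ≤ Z G lam

/-- The crux, restated through `lamC`, `Witness` (definitionally). [folklore] -/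
theorem crux_iff : Summit.PneNP.PneNP.Theses.PhaseTwins.MacroscopicTwinsAbove ↔
    ∀ Δ : ℕ, 3 ≤ Δ → ∀ lam : ℝ, lamC Δ < lam → ∃ δ : ℝ, 0 < δ ∧ ∀ k : ℕ,
      ∃ (n : ℕ) (G H : SimpleGraph (Fin n)), Witness Δ lam δ k n G H :=
  Iff.rfl

open Literature.ModelTheory.FiniteModelTheory in
/-- With at least as many pebble pairs as vertices, Duplicator's winning strategy yields an
isomorphism (pebble every vertex). [folklore] -/
theorem iso_of_ckEquiv_of_card_le {n k : ℕ} {G H : SimpleGraph (Fin n)} (h : CkEquiv k G H)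
    (hnk : n ≤ k) : Nonempty (G ≃g H) := by
  obtain ⟨S⟩ := h
  have key : ∀ t ≤ n, ∃ p ∈ S.carrier, ∃ b : Fin n → Fin n,
      p.ncard ≤ t ∧ ∀ i : Fin n, (i : ℕ) < t → (i, b i) ∈ p := by
    intro t
    induction t with
    | zero => exact fun _ => ⟨∅, S.empty_mem, id, by simp, fun i hi => (Nat.not_lt_zero _ hi).elim⟩
    | succ t ih =>
      intro ht
      obtain ⟨p, hp, b, hcard, hmem⟩ := ih (Nat.le_of_succ_le ht)
      have htn : t < n := ht
      obtain ⟨f, hf⟩ := S.forth hp (by omega)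
      set a : Fin n := ⟨t, htn⟩ with ha
      refine ⟨insert (a, f a) p, hf a, Function.update b a (f a), ?_, fun i hi => ?_⟩
      · exact (Set.ncard_insert_le _ _).trans (by omega)
      · rcases Nat.lt_succ_iff_lt_or_eq.1 hi with hlt | heq
        · have hia : i ≠ a := fun h => by rw [h] at hlt; exact lt_irrefl _ hlt
          rw [Function.update_of_ne hia]
          exact Set.mem_insert_of_mem _ (hmem i hlt)
        · have hia : i = a := Fin.ext heq
          subst hia
          rw [Function.update_self]
          exact Set.mem_insert _ _
  obtain ⟨p, hp, b, -, hmem⟩ := key n le_rfl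
  have hiso := S.isPartialIso_of_mem hp
  have hinj : Function.Injective b := fun i j hij =>
    (hiso.eq_iff (hmem i i.isLt) (hmem j j.isLt)).2 hij
  have hbij : Function.Bijective b := Finite.injective_iff_bijective.1 hinj
  exact ⟨⟨Equiv.ofBijective b hbij, fun {i j} => (hiso.adj_iff (hmem i i.isLt) (hmem j j.isLt)).symm⟩⟩

open Literature.ModelTheory.FiniteModelTheory in
/-- Hence every witness of the crux at depth `k` has MORE THAN `k` vertices: `n` must grow with
`k` (there is no single pair serving all `k`; the Dvořák bridge is PROVED in the tree). [folklore] -/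
theorem lt_card_of_witness {Δ : ℕ} {lam δ : ℝ} {k n : ℕ} {G H : SimpleGraph (Fin n)}
    (hδ : 0 < δ) (hlam : 0 ≤ lam) (hw : Witness Δ lam δ k n G H) : k < n := by
  by_contra hkn
  have hkn : n ≤ k := not_lt.1 hkn
  obtain ⟨hn, -, -, hhom, hgap⟩ := hw
  have hk1 : 1 ≤ k := hn.trans_le hkn
  have hck : CkEquiv k G H :=
    (Dvorak2010_ckEquiv_iff_homCount_holds.homCount_iff_ckEquiv k hk1 n n G H).1 hhom
  obtain ⟨e⟩ := iso_of_ckEquiv_of_card_le hck hkn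
  rw [Z_eq_of_iso e lam] at hgap
  have hZH := Z_pos H hlam
  have h1 : Real.exp (δ * n) ≤ 1 := by
    by_contra hc
    have := mul_lt_mul_of_pos_right (not_le.1 hc) hZH
    linarith
  have h2 : 1 < Real.exp (δ * n) := Real.one_lt_exp_iff.2 (mul_pos hδ (Nat.cast_pos.2 hn))
  linarith

/-- The strengthening "one pair of twins serves every depth `k`" is FALSE. [folklore] -/
theorem not_singlePair : ¬ ∃ (Δ : ℕ) (lam δ : ℝ) (n : ℕ) (G H : SimpleGraph (Fin n)),
    0 ≤ lam ∧ 0 < δ ∧ ∀ k, Witness Δ lam δ k n G H := by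
  rintro ⟨Δ, lam, δ, n, G, H, hlam, hδ, hw⟩
  exact lt_irrefl n (lt_card_of_witness hδ hlam (hw n))


end Summit.PneNP.PneNP.Theorems.MacroscopicTwinsAbove.Negative
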